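import Literature.MathematicalPhysics.QuantumFieldTheory.Balaban1983to89.T3UnitScaleTilt
import Summits.QuantumFields.YangMills.Theorems.EquipartitionCriticalityEquipartitionPinsProbeTangentHaarShiftSkew
import HarnessLib

/-!
# Line «covariant_discharge» on crux `HistoryTailL` (stmt-QuantumFields-19936) — its ENGINE: the Haar-exact sweep reweighting
# identity for Bałaban's Wilson–Gibbs measures `gibbsMeasure P β` / `T3UnitScaleTilt.gibbsK`, and the tail corollary

Cell `ym3-torus` (YM ladder rung R3 = continuum SU(2) Yang–Mills on the three-torus — a RUNG, NOT the Clay problem: not d = 4, not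
infinite volume, not a mass gap), width seat `ym-ust-19936-w3` gen 8, helper for the crux `HistoryTailL` (stmt-QuantumFields-19936).
The registered line «covariant_discharge» (`Cruxes/HistoryTailL/Lines/covariant_discharge.lean`, route `CovariantDischarge`) attacks the
first-exit window tail by a *covariant Cameron–Martin sweep*: a finite composition `Ψ` of single-link left translations
`U_b ↦ n_b(U)·U_b` whose direction `n_b(U)` is a function of the OTHER links only.  Its card states the mechanism in one sentence:
«each factor is fieldMeasure-preserving (skew product over left-Haar invariance), hence
`Gibbs_K(A) = E_Gibbs[1_A(ΨU)·exp(−β_K(S(ΨU)−S(U)))]` EXACTLY — no Jacobian, no gauge fixing inside the measure, no boundary term».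
THIS FILE proves exactly that sentence, for Bałaban's setup (`Setup.fieldMeasure`, `Missing.boltzmann`, `T4GenFunBounds.gibbsMeasure`,
`T3UnitScaleTilt.gibbsK`), for a GENERIC compact gauge group `G` with Haar datum:

* §1 `measurePreserving_update_mul_left/right` — a single-link skew translation with a measurable direction field not reading the
  translated link preserves the product Haar measure `dU` on `T^{(j)}` (the generic pi-measure skew-product lemma of the tree,
  `EquipartitionPinsProbe.TangentHaarShiftSkew.measurePreserving_skewShift`, at `ι = PBond P j`, `μ = HaarData.haar`); its inverse is the
  skew translation by `n(U)⁻¹` (`leftInverse_update_inv_mul_left`, …); measurability.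
* §2 `measurePreserving_foldr_comp`, `measurable_foldr_comp`, `leftInverse_foldr_comp` — SWEEPS: finite compositions of such maps
  (any list) are again measure preserving, measurable, and inverted by the reversed list of inverses (pure bookkeeping).
* §3 THE IDENTITY for `gibbsMeasure P β` (`β ≥ 0`) and every `dU`-preserving measurable bijection `Ψ` with measurable inverse `Ψ'`:
  `integral_comp_gibbsMeasure` (`∫ f(ΨU) dμ_β = ∫ f(U)·e^{−β(A(Ψ'U)−A(U))} dμ_β`), `integral_gibbsMeasure_eq_integral_comp_mul_exp`
  (`∫ f dμ_β = ∫ f(ΨU)·e^{−β(A(ΨU)−A(U))} dμ_β(U)` — the card's form), the set form `measureReal_gibbsMeasure_eq_setIntegral`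
  (`μ_β(A) = ∫_{Ψ⁻¹A} e^{−β(A(ΨU)−A(U))} dμ_β`), and the TAIL COROLLARY `measureReal_gibbsMeasure_le_exp_neg_mul`:
  an action gap `m ≤ β(A(ΨU) − A(U))` whenever `ΨU ∈ A` gives `μ_β(A) ≤ e^{−m}·μ_β(Ψ⁻¹A) ≤ e^{−m}`.
* §4 the same at `T3UnitScaleTilt.gibbsK F ℰ γ K` (`β_K = (F.scheme ℰ γ).β K ≥ 0` for `γ ≥ 0`), incl. the one-link instance
  `gibbsK_real_le_exp_neg_of_update_mul_left`.

WHAT THIS IS NOT.  This is the exact change-of-variables ENGINE only.  Nothing here bounds the action difference on the window event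
(the deterministic defect budget, the `S²`-net over directions, the frames) — that is the XL content of `stub_unboundedDepth`; nothing of
`stub_unboundedDepth`, `DeepWindowTailL`, `FractionalWindowTailL`, the crux `HistoryTailL`, the rung R3, d = 4, a continuum limit or a
mass gap is proved.  YM₃ on T³ is rung R3 of the programme, NOT the Clay problem.

References: T. Bałaban, CMP **98** (1985) 17–51 [Balaban1985Averaging] ((10) p.19: the product Haar measure `dU`); CMP **102** (1985)
255–275 [Balaban1985UV3] ((1)–(3) p.256: the Wilson density `exp(−g₀⁻²A(U))`).  The identity itself is measure-theoretic folklore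
(left invariance of Haar measure as a skew product + change of variables).
-/

noncomputable section

open MeasureTheory
open Literature.MathematicalPhysics.QuantumFieldTheory.Balaban1983to89
open Literature.MathematicalPhysics.QuantumFieldTheory.Balaban1983to89.Missing (boltzmann partitionFn measurable_wilsonAction4)
open Literature.MathematicalPhysics.QuantumFieldTheory.Balaban1983to89.T3ContinuumYM3Torus
open Literature.MathematicalPhysics.QuantumFieldTheory.Balaban1983to89.T3UnitScaleTilt
open Summit.QuantumFields.YangMills.Theorems.EquipartitionPinsProbe.TangentHaarShiftSkew
  (measurePreserving_skewShift measurable_skewShift leftInverse_skewShift)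

namespace Summit.QuantumFields.YangMills.Theorems.CovariantDischargeHaarSweepReweighting

/-! ## §1 Single-link skew translations preserve the product Haar measure `dU` on `T^{(j)}` -/

section SingleLink

variable {P : Params} {j : ℕ} {G : Type*} [GaugeGroup G] [MeasurableSpace G] [HaarData G] [MeasurableMul₂ G]
  [DecidableEq (PBond P j)]

omit [MeasurableSpace G] [HaarData G] [MeasurableMul₂ G] in
/-- The skew left translation of the link `b` by `n(U)` followed by the one by `n(U)⁻¹` is the identity, when the direction
field `n` does not read the link `b`. [folklore] -/
theorem leftInverse_update_inv_mul_left (b : PBond P j) {n : GaugeField P j G → G}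
    (hnb : ∀ (U : GaugeField P j G) (g : G), n (Function.update U b g) = n U) :
    Function.LeftInverse (fun U : GaugeField P j G => Function.update U b ((n U)⁻¹ * U b))
      (fun U : GaugeField P j G => Function.update U b (n U * U b)) :=
  leftInverse_skewShift b (k := fun U h => n U * h) (k' := fun U h => (n U)⁻¹ * h)
    (fun U g h => congrArg (fun x : G => x⁻¹ * h) (hnb U g)) (fun U g => inv_mul_cancel_left (n U) g)

omit [MeasurableSpace G] [HaarData G] [MeasurableMul₂ G] in
/-- The skew left translation of the link `b` by `n(U)⁻¹` followed by the one by `n(U)` is the identity, when the direction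
field `n` does not read the link `b`. [folklore] -/
theorem leftInverse_update_mul_left (b : PBond P j) {n : GaugeField P j G → G}
    (hnb : ∀ (U : GaugeField P j G) (g : G), n (Function.update U b g) = n U) :
    Function.LeftInverse (fun U : GaugeField P j G => Function.update U b (n U * U b))
      (fun U : GaugeField P j G => Function.update U b ((n U)⁻¹ * U b)) :=
  leftInverse_skewShift b (k := fun U h => (n U)⁻¹ * h) (k' := fun U h => n U * h)
    (fun U g h => congrArg (fun x : G => x * h) (hnb U g)) (fun U g => mul_inv_cancel_left (n U) g)

omit [MeasurableSpace G] [HaarData G] [MeasurableMul₂ G] in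
/-- Right-translation twin: `U_b ↦ U_b·n(U)` followed by `U_b ↦ U_b·n(U)⁻¹` is the identity. [folklore] -/
theorem leftInverse_update_mul_inv_right (b : PBond P j) {n : GaugeField P j G → G}
    (hnb : ∀ (U : GaugeField P j G) (g : G), n (Function.update U b g) = n U) :
    Function.LeftInverse (fun U : GaugeField P j G => Function.update U b (U b * (n U)⁻¹))
      (fun U : GaugeField P j G => Function.update U b (U b * n U)) :=
  leftInverse_skewShift b (k := fun U h => h * n U) (k' := fun U h => h * (n U)⁻¹)
    (fun U g h => congrArg (fun x : G => h * x⁻¹) (hnb U g)) (fun U g => mul_inv_cancel_right g (n U))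

omit [MeasurableSpace G] [HaarData G] [MeasurableMul₂ G] in
/-- Right-translation twin: `U_b ↦ U_b·n(U)⁻¹` followed by `U_b ↦ U_b·n(U)` is the identity. [folklore] -/
theorem leftInverse_update_mul_right (b : PBond P j) {n : GaugeField P j G → G}
    (hnb : ∀ (U : GaugeField P j G) (g : G), n (Function.update U b g) = n U) :
    Function.LeftInverse (fun U : GaugeField P j G => Function.update U b (U b * n U))
      (fun U : GaugeField P j G => Function.update U b (U b * (n U)⁻¹)) :=
  leftInverse_skewShift b (k := fun U h => h * (n U)⁻¹) (k' := fun U h => h * n U)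
    (fun U g h => congrArg (fun x : G => h * x) (hnb U g)) (fun U g => inv_mul_cancel_right g (n U))

omit [HaarData G] in
/-- The skew left translation `U ↦ update U b (n(U)·U_b)` is measurable for a measurable direction field `n`. [folklore] -/
theorem measurable_update_mul_left (b : PBond P j) {n : GaugeField P j G → G} (hn : Measurable n) :
    Measurable (fun U : GaugeField P j G => Function.update U b (n U * U b)) :=
  measurable_skewShift b (k := fun U h => n U * h) ((hn.comp measurable_fst).mul measurable_snd)

omit [HaarData G] in
/-- The skew left translation by the inverse direction `U ↦ update U b (n(U)⁻¹·U_b)` is measurable. [folklore] -/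
theorem measurable_update_inv_mul_left [MeasurableInv G] (b : PBond P j) {n : GaugeField P j G → G} (hn : Measurable n) :
    Measurable (fun U : GaugeField P j G => Function.update U b ((n U)⁻¹ * U b)) :=
  measurable_skewShift b (k := fun U h => (n U)⁻¹ * h) ((hn.comp measurable_fst).inv.mul measurable_snd)

omit [HaarData G] in
/-- The skew right translation `U ↦ update U b (U_b·n(U))` is measurable for a measurable direction field `n`. [folklore] -/
theorem measurable_update_mul_right (b : PBond P j) {n : GaugeField P j G → G} (hn : Measurable n) :
    Measurable (fun U : GaugeField P j G => Function.update U b (U b * n U)) :=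
  measurable_skewShift b (k := fun U h => h * n U) (measurable_snd.mul (hn.comp measurable_fst))

omit [HaarData G] in
/-- The skew right translation by the inverse direction `U ↦ update U b (U_b·n(U)⁻¹)` is measurable. [folklore] -/
theorem measurable_update_mul_inv_right [MeasurableInv G] (b : PBond P j) {n : GaugeField P j G → G} (hn : Measurable n) :
    Measurable (fun U : GaugeField P j G => Function.update U b (U b * (n U)⁻¹)) :=
  measurable_skewShift b (k := fun U h => h * (n U)⁻¹) (measurable_snd.mul (hn.comp measurable_fst).inv)

/-- **SKEW LEFT TRANSLATION OF ONE LINK PRESERVES `dU`.**  For a bond `b` of `T^{(j)}` and a measurable direction field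
`n : (gauge fields) → G` which does NOT read the link `b` (`n (update U b g) = n U`), the map `U ↦ update U b (n(U)·U_b)` preserves the
product Haar measure `dU = Π_b dU(b)` ([Balaban1985Averaging] (10)): left invariance of Haar measure in the coordinate `b`, as a skew
product over the remaining coordinates. [cite: Balaban1985Averaging, (10) p.19] -/
theorem measurePreserving_update_mul_left (b : PBond P j) {n : GaugeField P j G → G} (hn : Measurable n)
    (hnb : ∀ (U : GaugeField P j G) (g : G), n (Function.update U b g) = n U) :
    MeasurePreserving (fun U : GaugeField P j G => Function.update U b (n U * U b))
      (fieldMeasure P j G) (fieldMeasure P j G) := by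
  unfold fieldMeasure
  exact measurePreserving_skewShift (HaarData.haar (G := G)) b (k := fun U h => n U * h)
    (fun U g h => congrArg (fun x : G => x * h) (hnb U g)) ((hn.comp measurable_fst).mul measurable_snd)
    (fun x => ⟨measurable_const_mul (n x), HaarData.map_mul_left (n x)⟩)

/-- **SKEW RIGHT TRANSLATION OF ONE LINK PRESERVES `dU`** (`U ↦ update U b (U_b·n(U))`, right invariance of Haar measure in the
coordinate `b` as a skew product). [cite: Balaban1985Averaging, (10) p.19] -/
theorem measurePreserving_update_mul_right (b : PBond P j) {n : GaugeField P j G → G} (hn : Measurable n)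
    (hnb : ∀ (U : GaugeField P j G) (g : G), n (Function.update U b g) = n U) :
    MeasurePreserving (fun U : GaugeField P j G => Function.update U b (U b * n U))
      (fieldMeasure P j G) (fieldMeasure P j G) := by
  unfold fieldMeasure
  exact measurePreserving_skewShift (HaarData.haar (G := G)) b (k := fun U h => h * n U)
    (fun U g h => congrArg (fun x : G => h * x) (hnb U g)) (measurable_snd.mul (hn.comp measurable_fst))
    (fun x => ⟨measurable_mul_const (n x), HaarData.map_mul_right (n x)⟩)

/-- The inverse skew left translation `U ↦ update U b (n(U)⁻¹·U_b)` also preserves `dU`. [cite: Balaban1985Averaging, (10) p.19] -/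
theorem measurePreserving_update_inv_mul_left [MeasurableInv G] (b : PBond P j) {n : GaugeField P j G → G}
    (hn : Measurable n) (hnb : ∀ (U : GaugeField P j G) (g : G), n (Function.update U b g) = n U) :
    MeasurePreserving (fun U : GaugeField P j G => Function.update U b ((n U)⁻¹ * U b))
      (fieldMeasure P j G) (fieldMeasure P j G) :=
  measurePreserving_update_mul_left b (n := fun U => (n U)⁻¹) hn.inv (fun U g => congrArg (fun x : G => x⁻¹) (hnb U g))

end SingleLink

/-! ## §2 Sweeps: finite compositions of admissible maps -/

section Sweep

variable {α : Type*}

/-- `foldr (∘)` with an arbitrary seed factors through the seed. [folklore] -/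
theorem foldr_comp_eq_comp (l : List (α → α)) (g : α → α) :
    l.foldr (· ∘ ·) g = l.foldr (· ∘ ·) id ∘ g := by
  induction l with
  | nil => rfl
  | cons Ψ l ih => simp only [List.foldr_cons, ih]; rfl

/-- A sweep (the composition `Ψ₁ ∘ ⋯ ∘ Ψ_n` of a list of maps) is inverted on the left by the reversed list of left inverses
`Ψ_n' ∘ ⋯ ∘ Ψ₁'`. [folklore] -/
theorem leftInverse_foldr_comp (l : List ((α → α) × (α → α)))
    (h : ∀ p ∈ l, Function.LeftInverse p.2 p.1) :
    Function.LeftInverse ((l.map Prod.snd).reverse.foldr (· ∘ ·) id) ((l.map Prod.fst).foldr (· ∘ ·) id) := by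
  induction l with
  | nil => intro x; rfl
  | cons p l ih =>
    intro x
    have ih' := ih (fun q hq => h q (List.mem_cons_of_mem p hq))
    have hp := h p List.mem_cons_self
    simp only [List.map_cons, List.reverse_cons, List.foldr_append, List.foldr_cons, List.foldr_nil]
    rw [foldr_comp_eq_comp]
    simp only [Function.comp_apply, id]
    rw [hp]
    exact ih' x

/-- A sweep is inverted on the right by the reversed list of right inverses. [folklore] -/
theorem rightInverse_foldr_comp (l : List ((α → α) × (α → α)))
    (h : ∀ p ∈ l, Function.RightInverse p.2 p.1) :
    Function.RightInverse ((l.map Prod.snd).reverse.foldr (· ∘ ·) id) ((l.map Prod.fst).foldr (· ∘ ·) id) := by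
  -- the right-inverse statement for `l` is the left-inverse statement for the swapped, reversed list
  have h' : ∀ p ∈ (l.map Prod.swap).reverse, Function.LeftInverse p.2 p.1 := by
    intro p hp
    rw [List.mem_reverse, List.mem_map] at hp
    obtain ⟨q, hq, rfl⟩ := hp
    exact h q hq
  have key := leftInverse_foldr_comp _ h'
  simp only [List.map_reverse, List.map_map, List.reverse_reverse] at key
  exact key

variable [MeasurableSpace α]

/-- A sweep of measurable maps is measurable. [folklore] -/
theorem measurable_foldr_comp (l : List (α → α)) (h : ∀ Ψ ∈ l, Measurable Ψ) :
    Measurable (l.foldr (· ∘ ·) id) := by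
  induction l with
  | nil => exact measurable_id
  | cons Ψ l ih =>
    rw [List.foldr_cons]
    exact (h Ψ List.mem_cons_self).comp (ih fun Φ hΦ => h Φ (List.mem_cons_of_mem Ψ hΦ))

/-- **SWEEPS PRESERVE THE MEASURE**: a finite composition of `μ`-preserving maps is `μ`-preserving. [folklore] -/
theorem measurePreserving_foldr_comp {μ : Measure α} (l : List (α → α)) (h : ∀ Ψ ∈ l, MeasurePreserving Ψ μ μ) :
    MeasurePreserving (l.foldr (· ∘ ·) id) μ μ := by
  induction l with
  | nil => exact MeasurePreserving.id μ
  | cons Ψ l ih =>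
    rw [List.foldr_cons]
    exact (h Ψ List.mem_cons_self).comp (ih fun Φ hΦ => h Φ (List.mem_cons_of_mem Ψ hΦ))

end Sweep

/-! ## §3 The reweighting identity for `gibbsMeasure P β` and the tail corollary -/

section Reweighting

variable {P : Params} {G : Type*} [GaugeGroup G] [MeasurableSpace G] [HaarData G] [RegularGaugeGroup G]

/-- **CHANGE OF VARIABLES IN A WILSON–GIBBS AVERAGE (Bałaban setup).**  For `β ≥ 0`, a `dU`-preserving measurable bijection `Ψ` of
the fine gauge fields with measurable inverse `Ψ'`, and EVERY real observable `f`: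
`∫ f(ΨU) dμ_β(U) = ∫ f(U)·exp(−β(A(Ψ'U) − A(U))) dμ_β(U)`, `μ_β = gibbsMeasure P β = Z⁻¹e^{−βA}dU`, `A = wilsonAction4`: both sides are
`Z⁻¹∫ f(ΨU)e^{−βA(U)} dU` after the substitution `V = ΨU` in the right-hand numerator and telescoping of the Boltzmann factors; no
measurability of `f` is needed (both sides are the same possibly-junk Bochner integral). [cite: Balaban1985UV3, (1)-(3) p.256] -/
theorem integral_comp_gibbsMeasure {β : ℝ} (hβ : 0 ≤ β) {Ψ Ψ' : GaugeField P 0 G → GaugeField P 0 G}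
    (hΨ : MeasurePreserving Ψ (fieldMeasure P 0 G) (fieldMeasure P 0 G)) (hΨ' : Measurable Ψ')
    (h₁ : Function.LeftInverse Ψ' Ψ) (h₂ : Function.RightInverse Ψ' Ψ) (f : GaugeField P 0 G → ℝ) :
    ∫ U, f (Ψ U) ∂(T4GenFunBounds.gibbsMeasure P β) =
      ∫ U, f U * Real.exp (-(β * (wilsonAction4 (Ψ' U) - wilsonAction4 U))) ∂(T4GenFunBounds.gibbsMeasure P β) := by
  rw [T4GenFunBounds.integral_gibbsMeasure P hβ, T4GenFunBounds.integral_gibbsMeasure P hβ]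
  congr 1
  let Te : GaugeField P 0 G ≃ᵐ GaugeField P 0 G :=
    { toFun := Ψ, invFun := Ψ', left_inv := h₁, right_inv := h₂, measurable_toFun := hΨ.measurable,
      measurable_invFun := hΨ' }
  have hTe : MeasurePreserving Te (fieldMeasure P 0 G) (fieldMeasure P 0 G) := hΨ
  rw [← hTe.integral_comp' (fun V => f V * Real.exp (-(β * (wilsonAction4 (Ψ' V) - wilsonAction4 V))) *
    boltzmann P β V)]
  refine integral_congr_ae (ae_of_all _ fun U => ?_)
  have hU : (Te U : GaugeField P 0 G) = Ψ U := rfl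
  simp only [hU, h₁ U, boltzmann]
  rw [mul_assoc, ← Real.exp_add]
  congr 2
  ring

/-- **THE HAAR-EXACT REWEIGHTING IDENTITY** (the card's form): for `β ≥ 0`, a `dU`-preserving measurable bijection `Ψ` with measurable
inverse, and EVERY real observable `f`:
`∫ f dμ_β = ∫ f(ΨU)·exp(−β(A(ΨU) − A(U))) dμ_β(U)` — «no Jacobian, no gauge fixing inside the measure, no boundary term».
[cite: Balaban1985UV3, (1)-(3) p.256] -/
theorem integral_gibbsMeasure_eq_integral_comp_mul_exp {β : ℝ} (hβ : 0 ≤ β) {Ψ Ψ' : GaugeField P 0 G → GaugeField P 0 G}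
    (hΨ : MeasurePreserving Ψ (fieldMeasure P 0 G) (fieldMeasure P 0 G)) (hΨ' : Measurable Ψ')
    (h₁ : Function.LeftInverse Ψ' Ψ) (h₂ : Function.RightInverse Ψ' Ψ) (f : GaugeField P 0 G → ℝ) :
    ∫ U, f U ∂(T4GenFunBounds.gibbsMeasure P β) =
      ∫ U, f (Ψ U) * Real.exp (-(β * (wilsonAction4 (Ψ U) - wilsonAction4 U))) ∂(T4GenFunBounds.gibbsMeasure P β) := by
  -- `Ψ'` is `dU`-preserving too (inverse of a `dU`-preserving measurable equivalence)
  let Te : GaugeField P 0 G ≃ᵐ GaugeField P 0 G :=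
    { toFun := Ψ, invFun := Ψ', left_inv := h₁, right_inv := h₂, measurable_toFun := hΨ.measurable,
      measurable_invFun := hΨ' }
  have hTe : MeasurePreserving Te (fieldMeasure P 0 G) (fieldMeasure P 0 G) := hΨ
  have hΨ'p : MeasurePreserving Ψ' (fieldMeasure P 0 G) (fieldMeasure P 0 G) := hTe.symm
  have key := integral_comp_gibbsMeasure (P := P) hβ hΨ'p hΨ.measurable h₂ h₁ (fun U => f (Ψ U))
  simpa only [h₂ _] using key

/-- **SET FORM**: `μ_β(A) = ∫_{Ψ⁻¹A} exp(−β(A(ΨU) − A(U))) dμ_β(U)` for every measurable event `A`. [cite: Balaban1985UV3, (1)-(3) p.256] -/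
theorem measureReal_gibbsMeasure_eq_setIntegral {β : ℝ} (hβ : 0 ≤ β) {Ψ Ψ' : GaugeField P 0 G → GaugeField P 0 G}
    (hΨ : MeasurePreserving Ψ (fieldMeasure P 0 G) (fieldMeasure P 0 G)) (hΨ' : Measurable Ψ')
    (h₁ : Function.LeftInverse Ψ' Ψ) (h₂ : Function.RightInverse Ψ' Ψ)
    {A : Set (GaugeField P 0 G)} (hA : MeasurableSet A) :
    (T4GenFunBounds.gibbsMeasure P β).real A =
      ∫ U in Ψ ⁻¹' A, Real.exp (-(β * (wilsonAction4 (Ψ U) - wilsonAction4 U))) ∂(T4GenFunBounds.gibbsMeasure P β) := by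
  rw [← integral_indicator_one hA, integral_gibbsMeasure_eq_integral_comp_mul_exp hβ hΨ hΨ' h₁ h₂ (A.indicator 1),
    ← integral_indicator (hΨ.measurable hA)]
  refine integral_congr_ae (ae_of_all _ fun U => ?_)
  by_cases hU : Ψ U ∈ A
  · have hU' : U ∈ Ψ ⁻¹' A := hU
    simp only [Set.indicator_of_mem hU, Set.indicator_of_mem hU', Pi.one_apply, one_mul]
  · have hU' : U ∉ Ψ ⁻¹' A := hU
    simp only [Set.indicator_of_notMem hU, Set.indicator_of_notMem hU', zero_mul]

/-- **THE TAIL COROLLARY** (how the line uses the identity): if the sweep `Ψ` RAISES the action by at least `m/β` whenever it lands in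
the event `A` — `m ≤ β(A(ΨU) − A(U))` for all `U` with `ΨU ∈ A` — then `μ_β(A) ≤ e^{−m}·μ_β(Ψ⁻¹A)`.  In the line: `A` = the first-exit window
intersected with `{Y_n̂ ≥ θ}`, `Ψ` = the covariant sweep with the sign of `n̂` chosen against the event, `m = (1−o(1))θ²/(2σ²) − DEFECT_max`.
[cite: Balaban1985UV3, (1)-(3) p.256] -/
theorem measureReal_gibbsMeasure_le_exp_neg_mul {β : ℝ} (hβ : 0 ≤ β) {Ψ Ψ' : GaugeField P 0 G → GaugeField P 0 G}
    (hΨ : MeasurePreserving Ψ (fieldMeasure P 0 G) (fieldMeasure P 0 G)) (hΨ' : Measurable Ψ')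
    (h₁ : Function.LeftInverse Ψ' Ψ) (h₂ : Function.RightInverse Ψ' Ψ)
    {A : Set (GaugeField P 0 G)} (hA : MeasurableSet A) {m : ℝ}
    (hgap : ∀ U, Ψ U ∈ A → m ≤ β * (wilsonAction4 (Ψ U) - wilsonAction4 U)) :
    (T4GenFunBounds.gibbsMeasure P β).real A ≤
      Real.exp (-m) * (T4GenFunBounds.gibbsMeasure P β).real (Ψ ⁻¹' A) := by
  haveI := T4GenFunBounds.isProbabilityMeasure_gibbsMeasure (G := G) P hβ
  have hS : MeasurableSet (Ψ ⁻¹' A) := hΨ.measurable hA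
  have hA4 := measurable_wilsonAction4 (P := P) (j := 0) (RegularGaugeGroup.measurable_reTr (G := G))
  have hgm : Measurable fun U : GaugeField P 0 G => Real.exp (-(β * (wilsonAction4 (Ψ U) - wilsonAction4 U))) :=
    Real.measurable_exp.comp (((hA4.comp hΨ.measurable).sub hA4).const_mul β).neg
  have hint : IntegrableOn (fun U : GaugeField P 0 G => Real.exp (-(β * (wilsonAction4 (Ψ U) - wilsonAction4 U))))
      (Ψ ⁻¹' A) (T4GenFunBounds.gibbsMeasure P β) := by
    refine IntegrableOn.of_bound (measure_lt_top _ _) hgm.aestronglyMeasurable (Real.exp (-m))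
      ((ae_restrict_iff' hS).mpr (ae_of_all _ fun U hU => ?_))
    rw [Real.norm_eq_abs, abs_of_pos (Real.exp_pos _)]
    exact Real.exp_le_exp.mpr (neg_le_neg (hgap U hU))
  rw [measureReal_gibbsMeasure_eq_setIntegral hβ hΨ hΨ' h₁ h₂ hA]
  calc ∫ U in Ψ ⁻¹' A, Real.exp (-(β * (wilsonAction4 (Ψ U) - wilsonAction4 U))) ∂(T4GenFunBounds.gibbsMeasure P β)
      ≤ ∫ U in Ψ ⁻¹' A, Real.exp (-m) ∂(T4GenFunBounds.gibbsMeasure P β) :=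
        setIntegral_mono_on hint (integrableOn_const (measure_ne_top _ _)) hS
          (fun U hU => Real.exp_le_exp.mpr (neg_le_neg (hgap U hU)))
    _ = Real.exp (-m) * (T4GenFunBounds.gibbsMeasure P β).real (Ψ ⁻¹' A) := by
        rw [setIntegral_const, smul_eq_mul, mul_comm]

/-- The tail corollary in its crude form `μ_β(A) ≤ e^{−m}` (`μ_β` is a probability measure). [cite: Balaban1985UV3, (1)-(3) p.256] -/
theorem measureReal_gibbsMeasure_le_exp_neg {β : ℝ} (hβ : 0 ≤ β) {Ψ Ψ' : GaugeField P 0 G → GaugeField P 0 G}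
    (hΨ : MeasurePreserving Ψ (fieldMeasure P 0 G) (fieldMeasure P 0 G)) (hΨ' : Measurable Ψ')
    (h₁ : Function.LeftInverse Ψ' Ψ) (h₂ : Function.RightInverse Ψ' Ψ)
    {A : Set (GaugeField P 0 G)} (hA : MeasurableSet A) {m : ℝ}
    (hgap : ∀ U, Ψ U ∈ A → m ≤ β * (wilsonAction4 (Ψ U) - wilsonAction4 U)) :
    (T4GenFunBounds.gibbsMeasure P β).real A ≤ Real.exp (-m) := by
  haveI := T4GenFunBounds.isProbabilityMeasure_gibbsMeasure (G := G) P hβ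
  refine (measureReal_gibbsMeasure_le_exp_neg_mul hβ hΨ hΨ' h₁ h₂ hA hgap).trans ?_
  exact (mul_le_mul_of_nonneg_left measureReal_le_one (Real.exp_nonneg _)).trans_eq (mul_one _)

end Reweighting

/-! ## §4 The same at the `K`-th Gibbs measure `T3UnitScaleTilt.gibbsK F ℰ γ K` of a Bałaban family -/

section GibbsK

variable (F : T3Family) {G : Type*} [GaugeGroup G] [MeasurableSpace G] [HaarData G] [RegularGaugeGroup G]
  (ℰ : LoopAverage G) {γ : ℝ}

/-- **THE REWEIGHTING IDENTITY FOR `gibbsK`**: for `γ ≥ 0`, every `K`, every `dU`-preserving measurable bijection `Ψ` of the level-`K`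
fine fields with measurable inverse, and EVERY `f`: `∫ f d(gibbsK K) = ∫ f(ΨU)·exp(−β_K(A(ΨU) − A(U))) d(gibbsK K)(U)`,
`β_K = (F.scheme ℰ γ).β K`. [cite: Balaban1985UV3, (1)-(3) p.256] -/
theorem integral_gibbsK_eq_integral_comp_mul_exp (hγ : 0 ≤ γ) (K : ℕ)
    {Ψ Ψ' : GaugeField (F.P K) 0 G → GaugeField (F.P K) 0 G}
    (hΨ : MeasurePreserving Ψ (fieldMeasure (F.P K) 0 G) (fieldMeasure (F.P K) 0 G)) (hΨ' : Measurable Ψ')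
    (h₁ : Function.LeftInverse Ψ' Ψ) (h₂ : Function.RightInverse Ψ' Ψ) (f : GaugeField (F.P K) 0 G → ℝ) :
    ∫ U, f U ∂(gibbsK F ℰ γ K) =
      ∫ U, f (Ψ U) * Real.exp (-((F.scheme ℰ γ).β K * (wilsonAction4 (Ψ U) - wilsonAction4 U))) ∂(gibbsK F ℰ γ K) :=
  integral_gibbsMeasure_eq_integral_comp_mul_exp (F.scheme_β_nonneg ℰ hγ K) hΨ hΨ' h₁ h₂ f

/-- **SET FORM FOR `gibbsK`**: `gibbsK_K(A) = ∫_{Ψ⁻¹A} exp(−β_K(A(ΨU) − A(U))) d(gibbsK K)`. [cite: Balaban1985UV3, (1)-(3) p.256] -/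
theorem gibbsK_real_eq_setIntegral (hγ : 0 ≤ γ) (K : ℕ)
    {Ψ Ψ' : GaugeField (F.P K) 0 G → GaugeField (F.P K) 0 G}
    (hΨ : MeasurePreserving Ψ (fieldMeasure (F.P K) 0 G) (fieldMeasure (F.P K) 0 G)) (hΨ' : Measurable Ψ')
    (h₁ : Function.LeftInverse Ψ' Ψ) (h₂ : Function.RightInverse Ψ' Ψ)
    {A : Set (GaugeField (F.P K) 0 G)} (hA : MeasurableSet A) :
    (gibbsK F ℰ γ K).real A =
      ∫ U in Ψ ⁻¹' A, Real.exp (-((F.scheme ℰ γ).β K * (wilsonAction4 (Ψ U) - wilsonAction4 U))) ∂(gibbsK F ℰ γ K) :=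
  measureReal_gibbsMeasure_eq_setIntegral (F.scheme_β_nonneg ℰ hγ K) hΨ hΨ' h₁ h₂ hA

/-- **THE TAIL COROLLARY FOR `gibbsK`**: an action gap `m ≤ β_K(A(ΨU) − A(U))` whenever `ΨU ∈ A` gives
`gibbsK_K(A) ≤ e^{−m}·gibbsK_K(Ψ⁻¹A)`. [cite: Balaban1985UV3, (1)-(3) p.256] -/
theorem gibbsK_real_le_exp_neg_mul (hγ : 0 ≤ γ) (K : ℕ)
    {Ψ Ψ' : GaugeField (F.P K) 0 G → GaugeField (F.P K) 0 G}
    (hΨ : MeasurePreserving Ψ (fieldMeasure (F.P K) 0 G) (fieldMeasure (F.P K) 0 G)) (hΨ' : Measurable Ψ')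
    (h₁ : Function.LeftInverse Ψ' Ψ) (h₂ : Function.RightInverse Ψ' Ψ)
    {A : Set (GaugeField (F.P K) 0 G)} (hA : MeasurableSet A) {m : ℝ}
    (hgap : ∀ U, Ψ U ∈ A → m ≤ (F.scheme ℰ γ).β K * (wilsonAction4 (Ψ U) - wilsonAction4 U)) :
    (gibbsK F ℰ γ K).real A ≤ Real.exp (-m) * (gibbsK F ℰ γ K).real (Ψ ⁻¹' A) :=
  measureReal_gibbsMeasure_le_exp_neg_mul (F.scheme_β_nonneg ℰ hγ K) hΨ hΨ' h₁ h₂ hA hgap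

/-- The crude tail corollary for `gibbsK`: `gibbsK_K(A) ≤ e^{−m}`. [cite: Balaban1985UV3, (1)-(3) p.256] -/
theorem gibbsK_real_le_exp_neg (hγ : 0 ≤ γ) (K : ℕ)
    {Ψ Ψ' : GaugeField (F.P K) 0 G → GaugeField (F.P K) 0 G}
    (hΨ : MeasurePreserving Ψ (fieldMeasure (F.P K) 0 G) (fieldMeasure (F.P K) 0 G)) (hΨ' : Measurable Ψ')
    (h₁ : Function.LeftInverse Ψ' Ψ) (h₂ : Function.RightInverse Ψ' Ψ)
    {A : Set (GaugeField (F.P K) 0 G)} (hA : MeasurableSet A) {m : ℝ}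
    (hgap : ∀ U, Ψ U ∈ A → m ≤ (F.scheme ℰ γ).β K * (wilsonAction4 (Ψ U) - wilsonAction4 U)) :
    (gibbsK F ℰ γ K).real A ≤ Real.exp (-m) :=
  measureReal_gibbsMeasure_le_exp_neg (F.scheme_β_nonneg ℰ hγ K) hΨ hΨ' h₁ h₂ hA hgap

/-- **ONE-LINK INSTANCE FOR `gibbsK`** (the factor of the sweep): for a bond `b` of the level-`K` fine lattice and a measurable
direction field `n` not reading `b`, an action gap `m ≤ β_K(A(U with U_b ↦ n(U)U_b) − A(U))` on the pre-image of `A` gives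
`gibbsK_K(A) ≤ e^{−m}`. [cite: Balaban1985UV3, (1)-(3) p.256] -/
theorem gibbsK_real_le_exp_neg_of_update_mul_left (hγ : 0 ≤ γ) (K : ℕ) [DecidableEq (PBond (F.P K) 0)]
    (b : PBond (F.P K) 0) {n : GaugeField (F.P K) 0 G → G} (hn : Measurable n)
    (hnb : ∀ (U : GaugeField (F.P K) 0 G) (g : G), n (Function.update U b g) = n U)
    {A : Set (GaugeField (F.P K) 0 G)} (hA : MeasurableSet A) {m : ℝ}
    (hgap : ∀ U : GaugeField (F.P K) 0 G, Function.update U b (n U * U b) ∈ A →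
      m ≤ (F.scheme ℰ γ).β K * (wilsonAction4 (Function.update U b (n U * U b)) - wilsonAction4 U)) :
    (gibbsK F ℰ γ K).real A ≤ Real.exp (-m) :=
  gibbsK_real_le_exp_neg F ℰ hγ K (measurePreserving_update_mul_left b hn hnb)
    (measurable_update_inv_mul_left b hn) (leftInverse_update_inv_mul_left b hnb)
    (leftInverse_update_mul_left b hnb) hA hgap

end GibbsK

end Summit.QuantumFields.YangMills.Theorems.CovariantDischargeHaarSweepReweighting

end
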